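import Summits.HubbardSuperconductivity.HubbardSuperconductivity.Theorems.AnisotropyChordInsertionEntropyReduction

/-!
# Route `AnisotropyChord` / H0 rotor rung: the entropy route — THE LANDAU LINK
# `(Λ_α) ∧ (K₂) ⇒ (IR_α)` (LEMMA M in variational, inverse-free form), and the chain
# `H1 ∧ (Λ_α) ∧ (K₂) ∧ (S ≤ S_max) ⇒ BEC`

Theory seat memo ROTOR-THEORY-7 §92–§93 (architecture v2): «(IR_α) ⟸[LEMMA M] (K₂: χ_L(k) ≥ χ₀, compressibility
as a LOWER bound) ∧ (Λ_α)».  LEMMA M (`zerothMoment_ge_gap_mul_invMoment`, abstract spectral form) says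
`S(k) ≥ ω₀(k) · m₋₁(k)`; here the inverse moment `m₋₁(k) = P⁻¹⟨ρ_{-k}ψ, (H − E₀)⁻¹ ρ_{-k}ψ⟩ = χ_L(k)/2` is
handled through its VARIATIONAL characterisation `⟨φ, A⁻¹ φ⟩ = sup_η (2 Re⟨η, φ⟩ − ⟨η, A η⟩)` (`A > 0`), so
that the compressibility lower bound (K₂) is the inverse-free statement «some trial state `η` of lattice
momentum `k` in the sector has `2 Re⟨η, ρ_{-k}ψ⟩ − ⟨η, (H − E₀) η⟩ ≥ χ₀ P`», and LEMMA M becomes the AM–GM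
inequality `two_re_sum_sub_le`.  With the sector Landau bound (Λ_α) (`LandauGapBound`, typed) applied to `η`:
`S(k) = ‖ρ_{-k}ψ‖²/P ≥ c χ₀ |k|_T^α`, i.e. (IR_α) with the same `α`.

* `two_re_sum_sub_le` — `2 Re⟨η, φ⟩ − g‖η‖² ≤ ‖φ‖²/g`;
* `sum_norm_sq_densityFluct` — `‖ψ · conj ρ_k‖² = P · S_ψ(k)`; `densityFluct_shift` — it has lattice momentum `k`;
  `densityFluct_mem_spinZSector`;
* `structureFactor_ge_of_gap_of_trial` — the finite-volume link;
* **`infraredStructureBound_of_landauGap`** — `(Λ_α)` (sector `M − 1`) ∧ (K₂, variational, inline) ⇒ `(IR_α)`;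
* **`eventualCondensate_of_onebody_landau`** — `H1 ∧ (Λ_α) ∧ (K₂) ∧ (S ≤ S_max) ⇒ BEC` along a density
  sequence `→ ρ ∈ (0,1)`: the entropy route now rests on H1, the Landau cell's (Λ_α), the compressibility
  lower bound (K₂) and the no-Bragg-peak bound only.
-/

set_option linter.dupNamespace false

noncomputable section

open Matrix Finset Filter Topology Complex
open scoped ComplexConjugate Real
open Literature.MathematicalPhysics.QuantumLattice Literature.Probability.LatticeModels

namespace Summit.HubbardSuperconductivity.HubbardSuperconductivity.Theorems.AnisotropyChord.InsertionEntropy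

/-! ## LEMMA M in variational form: an AM–GM inequality -/

/-- **AM–GM / variational LEMMA M:** `2 Re Σ conj(ηᵢ) φᵢ − g Σ|ηᵢ|² ≤ (Σ|φᵢ|²)/g` for `g > 0`
(the value of the variational functional of `A ≥ g` at any trial vector is at most `‖φ‖²/g = ⟨φ, g⁻¹ φ⟩`). [folklore] -/
theorem two_re_sum_sub_le {ι : Type*} [Fintype ι] (η φ : ι → ℂ) {g : ℝ} (hg : 0 < g) :
    2 * (∑ i, conj (η i) * φ i).re - g * ∑ i, ‖η i‖ ^ 2 ≤ (∑ i, ‖φ i‖ ^ 2) / g := by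
  rw [Complex.re_sum, Finset.mul_sum, Finset.mul_sum, Finset.sum_div, ← Finset.sum_sub_distrib]
  refine Finset.sum_le_sum fun i _ => ?_
  have h1 : (conj (η i) * φ i).re ≤ ‖η i‖ * ‖φ i‖ := by
    calc (conj (η i) * φ i).re ≤ ‖conj (η i) * φ i‖ := Complex.re_le_norm _
      _ = ‖η i‖ * ‖φ i‖ := by rw [norm_mul, Complex.norm_conj]
  have h2 : 2 * (‖η i‖ * ‖φ i‖) - g * ‖η i‖ ^ 2 ≤ ‖φ i‖ ^ 2 / g := by
    have key : ‖φ i‖ ^ 2 / g - (2 * (‖η i‖ * ‖φ i‖) - g * ‖η i‖ ^ 2) = (g * ‖η i‖ - ‖φ i‖) ^ 2 / g := by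
      field_simp
      ring
    have : 0 ≤ (g * ‖η i‖ - ‖φ i‖) ^ 2 / g := by positivity
    linarith
  linarith

/-! ## The density fluctuation vector `ψ · conj ρ_k` -/

variable {L : ℕ} [NeZero L]

/-- `‖ψ conj ρ_k‖² = Σ_σ ψ(σ)² |ρ_k(σ)|² = P · S_ψ(k)` (`P ≠ 0`). [folklore] -/
theorem sum_norm_sq_densityFluct (a : TensorIndex (TorusSite 2 L) 2 → ℝ) {P : ℝ} (hP : P ≠ 0)
    (k : TorusSite 2 L) :
    ∑ σ, ‖(a σ : ℂ) * conj (∑ s, if σ s = 0 then torusPhase L k s else 0)‖ ^ 2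
      = structureFactor L a P k * P := by
  rw [structureFactor_mul a hP k]
  refine Finset.sum_congr rfl fun σ _ => ?_
  rw [norm_mul, Complex.norm_conj, mul_pow, Complex.norm_real, Real.norm_eq_abs, sq_abs]

/-- The density fluctuation vector of a translation-invariant amplitude has lattice momentum `k`:
`(ψ conj ρ_k)(σ(· + v)) = φ_k(v) (ψ conj ρ_k)(σ)`. [folklore] -/
theorem densityFluct_shift (a : TensorIndex (TorusSite 2 L) 2 → ℝ) (hb : ∀ v σ, a (shiftConfig L v σ) = a σ)
    (k v : TorusSite 2 L) :
    (fun σ => (a (shiftConfig L v σ) : ℂ) *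
        conj (∑ s, if (shiftConfig L v σ) s = 0 then torusPhase L k s else 0))
      = torusPhase L k v • fun σ => (a σ : ℂ) * conj (∑ s, if σ s = 0 then torusPhase L k s else 0) := by
  funext σ
  rw [Pi.smul_apply, smul_eq_mul, densityMode_shiftConfig, hb, map_mul, Complex.conj_conj]
  ring

/-- The density fluctuation vector lies in the sector of `ψ` (same support). [folklore] -/
theorem densityFluct_mem_spinZSector (a : TensorIndex (TorusSite 2 L) 2 → ℝ) (M : ℝ)
    (ha : (fun σ => (a σ : ℂ)) ∈ spinZSector (Λ := TorusSite 2 L) 1 M) (k : TorusSite 2 L) :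
    (fun σ => (a σ : ℂ) * conj (∑ s, if σ s = 0 then torusPhase L k s else 0))
      ∈ spinZSector (Λ := TorusSite 2 L) 1 M := by
  rw [LiebMattis.mem_spinZSector_iff] at ha ⊢
  intro σ hσ
  apply ha σ
  intro h0
  apply hσ
  show (a σ : ℂ) * conj (∑ s, if σ s = 0 then torusPhase L k s else 0) = 0
  rw [h0, zero_mul]

/-! ## The finite-volume link -/

/-- **Finite-volume Landau link:** if a trial vector `η` satisfies the sector gap bound
`(E₀ + g)‖η‖² ≤ Re⟨η, Hη⟩` (`g > 0`) and the variational compressibility bound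
`X ≤ 2 Re⟨η, ψ conj ρ_k⟩ − (Re⟨η, Hη⟩ − E₀‖η‖²)`, then `g X / P ≤ S_ψ(k)`. [folklore] -/
theorem structureFactor_ge_of_gap_of_trial (a : TensorIndex (TorusSite 2 L) 2 → ℝ) {P : ℝ} (hP : 0 < P)
    (H : Matrix (TensorIndex (TorusSite 2 L) 2) (TensorIndex (TorusSite 2 L) 2) ℂ) (E₀ g X : ℝ) (hg : 0 < g)
    (k : TorusSite 2 L) (η : TensorIndex (TorusSite 2 L) 2 → ℂ)
    (hgap : (E₀ + g) * (∑ σ, ‖η σ‖ ^ 2) ≤ (∑ σ, conj (η σ) * (H.mulVec η) σ).re)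
    (hvar : X ≤ 2 * (∑ σ, conj (η σ) *
        ((a σ : ℂ) * conj (∑ s, if σ s = 0 then torusPhase L k s else 0))).re
        - ((∑ σ, conj (η σ) * (H.mulVec η) σ).re - E₀ * ∑ σ, ‖η σ‖ ^ 2)) :
    g * X / P ≤ structureFactor L a P k := by
  have hM := two_re_sum_sub_le η
    (fun σ => (a σ : ℂ) * conj (∑ s, if σ s = 0 then torusPhase L k s else 0)) hg
  rw [sum_norm_sq_densityFluct a hP.ne' k] at hM
  have h1 : X ≤ (structureFactor L a P k * P) / g := by
    have : g * ∑ σ, ‖η σ‖ ^ 2 ≤ (∑ σ, conj (η σ) * (H.mulVec η) σ).re - E₀ * ∑ σ, ‖η σ‖ ^ 2 := by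
      linarith
    linarith
  rw [div_le_iff₀ hP, ← le_div_iff₀' hg]
  exact h1

/-! ## The link on sector sequences and the composed chain -/

/-- **`(Λ_α) ∧ (K₂) ⇒ (IR_α)`** (theory seat memo ROTOR-THEORY-7 §92–§93, LEMMA M):  the sector Landau bound
for the reference sector `M − 1` together with the VARIATIONAL COMPRESSIBILITY LOWER BOUND (K₂) — eventually
in `L`, for every Perron reference amplitude `ψ` and every `k ≠ 0` there is a trial vector `η` in the sector,
of lattice momentum `k`, with `2 Re⟨η, ψ conj ρ_k⟩ − ⟨η, (H − E₀) η⟩ ≥ χ₀ P` (`⟺ χ_L(k) ≥ 2χ₀` by the variational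
principle for `(H − E₀)⁻¹`) — give `S_L(k) ≥ c χ₀ |k|_T^α`, i.e. `InfraredStructureBound` with the Landau
exponent. [folklore] -/
theorem infraredStructureBound_of_landauGap (Δ : ℝ) (M : ℕ → ℝ)
    (hΛ : LandauGapBound Δ (fun L => M L - 1))
    (hK : ∃ χ₀ > (0 : ℝ), ∀ᶠ L : ℕ in atTop, ∀ [NeZero L],
      ∀ aM : TensorIndex (TorusSite 2 L) 2 → ℝ, IsPerronSectorGroundAmplitude L Δ (M L - 1) aM →
        ∀ k : TorusSite 2 L, k ≠ 0 → ∃ η : TensorIndex (TorusSite 2 L) 2 → ℂ,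
          η ∈ spinZSector (Λ := TorusSite 2 L) 1 (M L - 1) ∧
          (∀ v, (fun σ => η (shiftConfig L v σ)) = torusPhase L k v • η) ∧
          χ₀ * ((L : ℝ) ^ 2 / 2 + (M L - 1)) ≤
            2 * (∑ σ, conj (η σ) *
                ((aM σ : ℂ) * conj (∑ s, if σ s = 0 then torusPhase L k s else 0))).re
              - ((∑ σ, conj (η σ) * ((xxzHamiltonian 1 (torusGraph 2 L) (-1) Δ).mulVec η) σ).re
                  - lowestEnergyInSector 1 (xxzHamiltonian 1 (torusGraph 2 L) (-1) Δ) (M L - 1)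
                      * ∑ σ, ‖η σ‖ ^ 2))
    (hP : ∀ᶠ L : ℕ in atTop, 0 < (L : ℝ) ^ 2 / 2 + (M L - 1)) :
    InfraredStructureBound Δ M := by
  obtain ⟨c, hc, α, hα, hΛ⟩ := hΛ
  obtain ⟨χ₀, hχ₀, hK⟩ := hK
  refine ⟨c * χ₀, mul_pos hc hχ₀, α, hα, ?_⟩
  filter_upwards [hΛ, hK, hP] with L hΛL hKL hPL
  intro _ aM haM k hk
  obtain ⟨η, hηsec, hηmom, hηvar⟩ := hKL aM haM k hk
  have hgap := hΛL k hk η hηsec hηmom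
  have hg : 0 < c * (torusNorm L k) ^ α := mul_pos hc (Real.rpow_pos_of_pos (torusNorm_pos hk) α)
  have h := structureFactor_ge_of_gap_of_trial aM hPL (xxzHamiltonian 1 (torusGraph 2 L) (-1) Δ)
    (lowestEnergyInSector 1 (xxzHamiltonian 1 (torusGraph 2 L) (-1) Δ) (M L - 1))
    (c * (torusNorm L k) ^ α) (χ₀ * ((L : ℝ) ^ 2 / 2 + (M L - 1))) hg k η hgap hηvar
  have e : c * (torusNorm L k) ^ α * (χ₀ * ((L : ℝ) ^ 2 / 2 + (M L - 1))) / ((L : ℝ) ^ 2 / 2 + (M L - 1))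
      = c * χ₀ * (torusNorm L k) ^ α := by
    rw [mul_div_assoc, mul_div_assoc, div_self hPL.ne', mul_one]
    ring
  rw [e] at h
  exact h

/-- The reference sector is eventually non-empty in particle number along a density sequence `→ ρ > 0`. [folklore] -/
theorem eventually_particleNumber_pos (M : ℕ → ℝ) (ρ : ℝ) (hρ : 0 < ρ)
    (hlim : Tendsto (fun L : ℕ => 1 / 2 + M L / (L : ℝ) ^ 2) atTop (𝓝 ρ)) :
    ∀ᶠ L : ℕ in atTop, 0 < (L : ℝ) ^ 2 / 2 + (M L - 1) := by
  have hlimM := tendsto_density_pred M ρ hlim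
  have h1 : ∀ᶠ L : ℕ in atTop, ρ / 2 ≤ 1 / 2 + (M L - 1) / (L : ℝ) ^ 2 :=
    hlimM.eventually (eventually_ge_nhds (by linarith))
  have h2 : ∀ᶠ L : ℕ in atTop, 1 ≤ L := eventually_ge_atTop 1
  filter_upwards [h1, h2] with L h1L h2L
  have hL : (0 : ℝ) < (L : ℝ) := by exact_mod_cast h2L
  have hL' : (L : ℝ) ≠ 0 := hL.ne'
  have e : (L : ℝ) ^ 2 / 2 + (M L - 1) = (L : ℝ) ^ 2 * (1 / 2 + (M L - 1) / (L : ℝ) ^ 2) := by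
    field_simp
  rw [e]
  have : 0 < 1 / 2 + (M L - 1) / (L : ℝ) ^ 2 := lt_of_lt_of_le (by linarith) h1L
  positivity

/-- **THE ENTROPY ROUTE ON THE LANDAU LAYER: `H1 ∧ (Λ_α) ∧ (K₂) ∧ (S ≤ S_max) ⇒ BEC`.**  Along a sector
sequence of density `1/2 + M_L/L² → ρ ∈ (0,1)` with eventually non-trivial reference sectors, the one-body
insertion structure H1, the sector Landau bound (Λ_α) for the reference sector, the variational
compressibility lower bound (K₂) and the upper structure bound imply eventual condensation of every Perron
sector ground state of the XXZ / hard-core boson torus (theory seat memo ROTOR-THEORY-7 §93/§100, with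
`infraredStructureBound_of_landauGap` and `eventualCondensate_of_onebody_infrared`). [folklore] -/
theorem eventualCondensate_of_onebody_landau (Δ : ℝ) (M : ℕ → ℝ) (ρ : ℝ)
    (hρ : ρ ∈ Set.Ioo (0 : ℝ) 1)
    (hlim : Tendsto (fun L : ℕ => 1 / 2 + M L / (L : ℝ) ^ 2) atTop (𝓝 ρ))
    (hsect : ∀ᶠ L : ℕ in atTop, ∀ [NeZero L], spinZSector (Λ := TorusSite 2 L) 1 (M L - 1) ≠ ⊥)
    (h1 : OneBodyInsertionStructure Δ M) (hΛ : LandauGapBound Δ (fun L => M L - 1))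
    (hK : ∃ χ₀ > (0 : ℝ), ∀ᶠ L : ℕ in atTop, ∀ [NeZero L],
      ∀ aM : TensorIndex (TorusSite 2 L) 2 → ℝ, IsPerronSectorGroundAmplitude L Δ (M L - 1) aM →
        ∀ k : TorusSite 2 L, k ≠ 0 → ∃ η : TensorIndex (TorusSite 2 L) 2 → ℂ,
          η ∈ spinZSector (Λ := TorusSite 2 L) 1 (M L - 1) ∧
          (∀ v, (fun σ => η (shiftConfig L v σ)) = torusPhase L k v • η) ∧
          χ₀ * ((L : ℝ) ^ 2 / 2 + (M L - 1)) ≤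
            2 * (∑ σ, conj (η σ) *
                ((aM σ : ℂ) * conj (∑ s, if σ s = 0 then torusPhase L k s else 0))).re
              - ((∑ σ, conj (η σ) * ((xxzHamiltonian 1 (torusGraph 2 L) (-1) Δ).mulVec η) σ).re
                  - lowestEnergyInSector 1 (xxzHamiltonian 1 (torusGraph 2 L) (-1) Δ) (M L - 1)
                      * ∑ σ, ‖η σ‖ ^ 2))
    (hS : StructureFactorUpper Δ M) : EventualCondensate Δ M :=
  eventualCondensate_of_onebody_infrared Δ M ρ hρ hlim hsect h1
    (infraredStructureBound_of_landauGap Δ M hΛ hK (eventually_particleNumber_pos M ρ hρ.1 hlim)) hS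

end Summit.HubbardSuperconductivity.HubbardSuperconductivity.Theorems.AnisotropyChord.InsertionEntropy
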